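import Summits.ValiantsHypothesis.ValiantsHypothesis.Theorems.BarrierLeverAnchoredDoorHitsLowerPairsRouting
import Summits.ValiantsHypothesis.ValiantsHypothesis.Theorems.BarrierLeverAnchoredDoorHitsLowerPairsBase
import Summits.ValiantsHypothesis.ValiantsHypothesis.Theorems.BarrierLeverAnchoredDoorHitsLowerPairsSwap
import Summits.ValiantsHypothesis.ValiantsHypothesis.Theorems.BarrierLeverAnchoredDoorHitsLowerPairsMono

/-!
# Support item `AnchoredDoorHitsLowerPairs` (stmt-ValiantsHypothesis-22510), line `anchored-peeling`:
# CONJECTURE P — ONE BARE PEEL WITH A GENERIC CORE IS NONSINGULAR EXACTLY WHEN HALL'S CONDITION HOLDS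

Helper file (`--supports stmt-ValiantsHypothesis-22510`; cell valiant-natproofs, rung V4, 𝒟-side door (c); registered line
`Cruxes/AnchoredDoorHitsLowerPairs/Lines/anchored_peeling.lean` v12; prover seat val-np-p1 gen 19). One `def … : Prop` (`Stmt.stub_onePeel`, the stub text
OFFERED to the planner under D-0145 — NOT asserted), the bookkeeping `def`s `DTPeel.onePeelStage`, `DTPeel.onePeelU`, `DTPeel.onePeelE`, and the landed transfer.
Closes NO item.

THE STATEMENT (memo HOME/val-np-p1/g19/PEEL-HALL-valnp1-g19.md §2). Peel ONE `x`-vertex `a` of an injective simplicial-complex pair `(u, w)` onto ONE column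
vertex `c` with the one-type DT stage `(B, c, D) = (∅, c, ∅)` of p595531 (`DTPeel.Stage`; always valid on plain rows): the rows `u i ∋ a` become the generalized
rows `(u i ∖ a | {c})`, every other row is kept, and ALL remaining parameters of the door stay symbolic (the "core" on `X ∖ a` is generic, including the other
anchors at the column `c`). In the zeon picture this is the layout of the specialised door `(1 + x_a y_c) · 𝔄_s(X ∖ a, Y)`. Hall's condition for the shifted
rows is `#{i : a ∈ u i} ≤ #{j : c ∈ w j}` (the `ℓ_a ≤ ℓ_c` of the memo; for `=` this is the landed star step `stub_starStep` at `s = 1`).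
**CONJECTURE P:** under Hall's condition the peeled generalized symbolic minor (profile 1) is nonzero.

* `Stmt.stub_onePeel` — Conjecture P (profile `1`).
* `symbolicDet_one_ne_zero_of_onePeel` — **TRANSFER**: P ⟹ `symbolicDet 1 h r u w ≠ 0` for every injective lower pair: for `r ≤ 1` by `stub_base`; otherwise both
  complexes have a vertex, and for any vertices `a`, `c` either `ℓ_a ≤ ℓ_c` (peel `a` onto `c`) or `ℓ_c < ℓ_a` (peel `c` onto `a` in the swapped pair,
  `symbolicDet_ne_zero_comm`); the DT-peel lemma (`DTPeel.Stage.genDet_ne_zero`) and `DTPeel.genDet_empty` carry the non-vanishing back. NO induction on `r` is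
  needed: P is a ONE-SHOT certificate-free sufficient condition. `stub_symbolicNonvanishing_of_onePeel` (`s := 1`, `h₀ := 0`), `anchoredHit_of_onePeel`.

EVIDENCE (val-np-p1 g19, lab/exp_pair*.py + kit j300812; exact rank mod 2⁶¹−1 at random parameters, two trials): nonsingular for EVERY `(a, c)` on the
Hall-feasible side for all 396 lower pairs ≤ 4×4 (5 436 vertex pairs), 1 279 vertex pairs of random lower pairs on (5,5),(6,4),(4,6),(7,4) wide,(6,5),(5,4)
deep,(6,6),(8,4),(7,5), and the rigid families `K₅`/cube₄, cube₄/`B(5,2)`, `P₃`, `P₄`, `P₅`, cube₆/`B(7,3)`, `K_n`/deep (`n ≤ 13`); Hall-infeasible peels are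
singular (forced zero block). The `k`-fold version (peel `k` `x`-vertices onto distinct columns: nonsingular ⟺ Hall on the trace up-sets) has 0 anomalies in
9 804 + 11 880 (k = 2) and 6 432 + 19 656 (k = 3) census instances; the general SUPPORT-GENERICITY form (generalized rows `(U|E)` AND columns `(B|W)`:
nonsingular ⟺ the support has a perfect matching — equivalently «multiplication by the generic door on the zeon algebra is a support-generic operator») has
0 anomalies in ≈ 3 000 random instances of the FULL door and FAILS for the crossed member (anchor-dependent `y`-tails are needed).
WHY IT MIGHT FAIL: it is strictly stronger than U1 on the peeled pair (a specialisation); a cheap falsifier is ONE lower pair with ONE Hall-feasible `(a, c)`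
whose peeled matrix is singular at two random parameter points (lab/exp_pair.py, milliseconds at `h ≤ 6`).
WHY IT IS USEFUL: the peeled matrix is block-triangular with RECTANGULAR diagonal blocks `𝔄(X∖a,Y∖c)[del_a R, del_c C]` (tall) and `𝔄(X∖a,Y∖c)[lk_a R, lk_c C]`
(wide), coupled only through the `c`-anchors `(b | c)`, `b ∈ X ∖ a`; the memo's (Q_s)-STEP (§4, proved on paper) extracts from it a cancellation-free monomial
whenever the syzygy space of the tall block has a coordinate basis with distinct roots of size `≤ s` — which covers every censused rigid/thick pair
(K₅/cube₄, `P_n`, cube₆/`B(7,3)`, `K_n`/deep and, at `s = 2`, `(K₉₀, cube₁₂)`).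

WHAT THIS IS NOT: no claim that Conjecture P holds; nothing on crux stmt-ValiantsHypothesis-14610 or on `VP` versus `VNP`.
-/

set_option linter.dupNamespace false

namespace Summit.ValiantsHypothesis.ValiantsHypothesis.Theorems.BarrierLever.AnchoredPeeling

open Finset MvPolynomial

noncomputable section

namespace DTPeel

variable {h r : ℕ}

/-- The one-type DT stage peeling the `x`-vertex `a` onto the column vertex `c`: type list `(∅, c, ∅)`, every row in class `0`. -/
def onePeelStage (h r : ℕ) (a c : Fin h) : Stage h r where
  a := a
  J := 1
  B := fun _ => ∅
  c := fun _ => c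
  D := fun _ => ∅
  cls := fun _ => 0

/-- The peeled `x`-sets: `a` is removed from every row (rows without `a` are unchanged). -/
def onePeelU (a : Fin h) (u : Fin r → Finset (Fin h)) : Fin r → Finset (Fin h) :=
  fun i => (u i).erase a

/-- The peeled `y`-shifts: the rows that contained `a` are shifted by `{c}`, the others stay plain. -/
def onePeelE (a c : Fin h) (u : Fin r → Finset (Fin h)) : Fin r → Finset (Fin h) :=
  fun i => if a ∈ u i then {c} else ∅

/-- The one-type stage is valid on plain rows. -/
theorem onePeelStage_valid (a c : Fin h) (u : Fin r → Finset (Fin h)) :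
    (onePeelStage h r a c).Valid u (fun _ => ∅) := by
  refine ⟨fun x y _ => Subsingleton.elim (α := Fin 1) x y, fun _ => Finset.notMem_empty _, fun _ => Finset.notMem_empty _,
    fun _ _ => Finset.empty_subset _, fun _ _ j hj => absurd hj (Nat.not_lt_zero _), fun _ _ => Finset.disjoint_empty_left _⟩

/-- The stage's new `x`-sets are `onePeelU`. -/
theorem onePeelStage_newU (a c : Fin h) (u : Fin r → Finset (Fin h)) :
    (onePeelStage h r a c).newU u = onePeelU a u := by
  funext i
  simp only [Stage.newU, onePeelStage, onePeelU, Finset.sdiff_empty]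
  split_ifs with hi
  · rfl
  · exact (Finset.erase_eq_of_notMem hi).symm

/-- The stage's new `y`-shifts on plain rows are `onePeelE`. -/
theorem onePeelStage_newE (a c : Fin h) (u : Fin r → Finset (Fin h)) :
    (onePeelStage h r a c).newE u (fun _ => ∅) = onePeelE a c u := by
  funext i
  simp only [Stage.newE, onePeelStage, onePeelE, Finset.empty_union, Finset.insert_empty]

end DTPeel

/-- **STUB (CONJECTURE P, profile 1).** For every injective simplicial-complex pair `(u, w)`, every `x`-vertex `a` lying in some row and every column vertex `c`
with HALL'S CONDITION `#{i : a ∈ u i} ≤ #{j : c ∈ w j}`, the generalized symbolic minor of the one-peeled layout — rows `(u i ∖ a | {c})` for `a ∈ u i`,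
rows `(u i | ∅)` otherwise, all other parameters symbolic — is nonzero. -/
def Stmt.stub_onePeel : Prop :=
  ∀ (h r : ℕ) (u w : Fin r → Finset (Fin h)), Function.Injective u → Function.Injective w →
    IsLowerSet (Set.range u) → IsLowerSet (Set.range w) →
    ∀ (a c : Fin h), (∃ i, a ∈ u i) →
      (Finset.univ.filter (fun i => a ∈ u i)).card ≤ (Finset.univ.filter (fun j => c ∈ w j)).card →
      DTPeel.genDet 1 h r (DTPeel.onePeelU a u) (DTPeel.onePeelE a c u) w ≠ 0

/-- One peel on the `x`-side certifies the symbolic minor (the DT-peel lemma for the one-type stage). -/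
theorem symbolicDet_ne_zero_of_peel_genDet {s h r : ℕ} (hs : 1 ≤ s) (u w : Fin r → Finset (Fin h)) (a c : Fin h)
    (hne : DTPeel.genDet s h r (DTPeel.onePeelU a u) (DTPeel.onePeelE a c u) w ≠ 0) : symbolicDet s h r u w ≠ 0 := by
  rw [← DTPeel.genDet_empty]
  refine (DTPeel.onePeelStage h r a c).genDet_ne_zero hs u (fun _ => ∅) w (DTPeel.onePeelStage_valid a c u) ?_
  rwa [DTPeel.onePeelStage_newU, DTPeel.onePeelStage_newE]

/-- In an injective family with at least two members some member is nonempty, hence has a vertex. -/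
private theorem exists_vertex_of_two_le {h r : ℕ} (u : Fin r → Finset (Fin h)) (hu : Function.Injective u) (hr : 2 ≤ r) :
    ∃ (a : Fin h) (i : Fin r), a ∈ u i := by
  by_contra hcon
  push Not at hcon
  have h0 : u ⟨0, by omega⟩ = u ⟨1, by omega⟩ := by
    rw [Finset.eq_empty_of_forall_notMem (fun a => hcon a _), Finset.eq_empty_of_forall_notMem (fun a => hcon a _)]
  have := hu h0
  simp [Fin.ext_iff] at this

/-- **TRANSFER: Conjecture P implies profile-1 symbolic non-vanishing on every injective simplicial-complex pair** (no induction: `r ≤ 1` by `stub_base`;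
else peel a vertex of the side with the smaller star onto a vertex of the other side, swapping the pair by `symbolicDet_ne_zero_comm` if needed). -/
theorem symbolicDet_one_ne_zero_of_onePeel (H : Stmt.stub_onePeel) (h r : ℕ) (u w : Fin r → Finset (Fin h))
    (hu : Function.Injective u) (hw : Function.Injective w) (hlu : IsLowerSet (Set.range u)) (hlw : IsLowerSet (Set.range w)) :
    symbolicDet 1 h r u w ≠ 0 := by
  by_cases hr : r ≤ 1
  · exact stub_base 1 h r u w hu hw hlu hlw hr
  · have hr2 : 2 ≤ r := by omega
    obtain ⟨a, i, hai⟩ := exists_vertex_of_two_le u hu hr2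
    obtain ⟨c, j, hcj⟩ := exists_vertex_of_two_le w hw hr2
    by_cases hle : (Finset.univ.filter (fun i => a ∈ u i)).card ≤ (Finset.univ.filter (fun j => c ∈ w j)).card
    · exact symbolicDet_ne_zero_of_peel_genDet le_rfl u w a c (H h r u w hu hw hlu hlw a c ⟨i, hai⟩ hle)
    · have hle' : (Finset.univ.filter (fun j => c ∈ w j)).card ≤ (Finset.univ.filter (fun i => a ∈ u i)).card := by omega
      exact (symbolicDet_ne_zero_comm 1 h r u w).mpr
        (symbolicDet_ne_zero_of_peel_genDet le_rfl w u c a (H h r w u hw hu hlw hlu c a ⟨j, hcj⟩ hle'))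

/-- **Conjecture P implies the line's symbolic non-vanishing stub** (`s := 1`, `h₀ := 0`). -/
theorem stub_symbolicNonvanishing_of_onePeel (H : Stmt.stub_onePeel) : Stmt.stub_symbolicNonvanishing :=
  ⟨1, 0, fun h _ r u w hu hw hlu hlw => symbolicDet_one_ne_zero_of_onePeel H h r u w hu hw hlu hlw⟩

/-- The same at any profile `s ≥ 1` (monotonicity in the profile). -/
theorem symbolicDet_ne_zero_of_onePeel (H : Stmt.stub_onePeel) {s : ℕ} (hs : 1 ≤ s) (h r : ℕ)
    (u w : Fin r → Finset (Fin h)) (hu : Function.Injective u) (hw : Function.Injective w)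
    (hlu : IsLowerSet (Set.range u)) (hlw : IsLowerSet (Set.range w)) : symbolicDet s h r u w ≠ 0 :=
  symbolicDet_ne_zero_mono hs (symbolicDet_one_ne_zero_of_onePeel H h r u w hu hw hlu hlw)

/-- Hence an anchored hit at every profile `s ≥ 1` (the landed `stub_genericPoint`). -/
theorem anchoredHit_of_onePeel (H : Stmt.stub_onePeel) {s : ℕ} (hs : 1 ≤ s) (h r : ℕ)
    (u w : Fin r → Finset (Fin h)) (hu : Function.Injective u) (hw : Function.Injective w)
    (hlu : IsLowerSet (Set.range u)) (hlw : IsLowerSet (Set.range w)) : AnchoredHit s h r u w :=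
  stub_genericPoint s h r u w (symbolicDet_ne_zero_of_onePeel H hs h r u w hu hw hlu hlw)

end

end Summit.ValiantsHypothesis.ValiantsHypothesis.Theorems.BarrierLever.AnchoredPeeling
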